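import Mathlib
import Literature.Analysis.ODE.IntegralGronwall
import Literature.Analysis.FunctionSpaces.FlatTorus
import Literature.MathematicalPhysics.KineticTheory.HardSphereEuler
import HarnessLib

/-!
# `EntropicWeakStrongHS` (stmt-AtomisticToContinuum-13461), part A: measure-theoretic tools for
# the abstract Dafermos stability shell

Helper lemmas (no hard-sphere content) used by the abstract relative-entropy stability shell
(`JaynesSqueezeEntropicWeakStrongHSShellB.lean`): the pairing `pair L U = L₁U₁ + Σⱼ L₂ⱼU₂ⱼ + L₃U₃`
on the state space `ℝ × ℝ³ × ℝ` (linearity, bounds, continuity), measurability of continuous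
functions of a compact-valued measurable field, uniform bounds by compactness, integrability in
`x ∈ 𝕋³` and in time of the space integrals of jointly measurable bounded integrands, an
`|y| ≤ (κ + y²/κ)/2` absorption, and a Grönwall step for a bounded measurable function satisfying
the integral inequality `φ ≤ A + C ∫₀ φ` on `[0, t]`.
-/

noncomputable section

open MeasureTheory Set Filter Function
open scoped BigOperators Topology

namespace Summit.AtomisticToContinuum.HydrodynamicLimit.Theorems.EntropicWeakStrong

open Literature.MathematicalPhysics.KineticTheory (T3 V3)

/-! ### The pairing -/

/-- Linearity of the pairing in its second argument (difference). -/
theorem pair_sub (pair : (ℝ × V3 × ℝ) → (ℝ × V3 × ℝ) → ℝ)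
    (hpair : pair = fun L U => L.1 * U.1 + (∑ j, L.2.1 j * U.2.1 j) + L.2.2 * U.2.2)
    (L V U : (ℝ × V3 × ℝ)) : pair L (V - U) = pair L V - pair L U := by
  subst hpair
  simp only [Prod.fst_sub, Prod.snd_sub, PiLp.sub_apply, mul_sub, Finset.sum_sub_distrib]
  ring

/-- The pairing is jointly continuous. -/
theorem continuous_pair (pair : (ℝ × V3 × ℝ) → (ℝ × V3 × ℝ) → ℝ)
    (hpair : pair = fun L U => L.1 * U.1 + (∑ j, L.2.1 j * U.2.1 j) + L.2.2 * U.2.2) :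
    Continuous (fun q : (ℝ × V3 × ℝ) × (ℝ × V3 × ℝ) => pair q.1 q.2) := by
  subst hpair
  fun_prop

/-- Componentwise bound of the pairing: if all components of `L` are at most `M` in absolute
value then `|pair L Y| ≤ M (|Y₁| + Σⱼ |Y₂ⱼ| + |Y₃|)`. -/
theorem abs_pair_le (pair : (ℝ × V3 × ℝ) → (ℝ × V3 × ℝ) → ℝ)
    (hpair : pair = fun L U => L.1 * U.1 + (∑ j, L.2.1 j * U.2.1 j) + L.2.2 * U.2.2)
    {L : (ℝ × V3 × ℝ)} {M : ℝ} (h1 : |L.1| ≤ M) (h2 : ∀ j, |L.2.1 j| ≤ M) (h3 : |L.2.2| ≤ M) (Y : (ℝ × V3 × ℝ)) :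
    |pair L Y| ≤ M * (|Y.1| + (∑ j, |Y.2.1 j|) + |Y.2.2|) := by
  subst hpair
  have hM : 0 ≤ M := (abs_nonneg _).trans h1
  dsimp only
  calc |L.1 * Y.1 + ∑ j, L.2.1 j * Y.2.1 j + L.2.2 * Y.2.2|
      ≤ |L.1 * Y.1| + |∑ j, L.2.1 j * Y.2.1 j| + |L.2.2 * Y.2.2| := abs_add_three _ _ _
    _ ≤ M * |Y.1| + (∑ j, M * |Y.2.1 j|) + M * |Y.2.2| := by
        refine add_le_add (add_le_add ?_ ?_) ?_
        · rw [abs_mul]; exact mul_le_mul_of_nonneg_right h1 (abs_nonneg _)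
        · refine (Finset.abs_sum_le_sum_abs _ _).trans (Finset.sum_le_sum fun j _ => ?_)
          rw [abs_mul]; exact mul_le_mul_of_nonneg_right (h2 j) (abs_nonneg _)
        · rw [abs_mul]; exact mul_le_mul_of_nonneg_right h3 (abs_nonneg _)
    _ = M * (|Y.1| + (∑ j, |Y.2.1 j|) + |Y.2.2|) := by rw [← Finset.mul_sum]; ring

/-- Components of a point of `ℝ × ℝ³ × ℝ` are bounded by its (sup) norm. -/
theorem abs_components_le_norm (L : (ℝ × V3 × ℝ)) :
    |L.1| ≤ ‖L‖ ∧ (∀ j, |L.2.1 j| ≤ ‖L‖) ∧ |L.2.2| ≤ ‖L‖ := by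
  refine ⟨?_, fun j => ?_, ?_⟩
  · simpa [Real.norm_eq_abs] using norm_fst_le L
  · have h1 : ‖L.2.1 j‖ ≤ ‖L.2.1‖ := by simpa using PiLp.norm_apply_le L.2.1 j
    have h2 : ‖L.2.1‖ ≤ ‖L.2‖ := norm_fst_le L.2
    have h3 : ‖L.2‖ ≤ ‖L‖ := norm_snd_le L
    rw [← Real.norm_eq_abs]
    linarith
  · have h2 : ‖L.2.2‖ ≤ ‖L.2‖ := norm_snd_le L.2
    have h3 : ‖L.2‖ ≤ ‖L‖ := norm_snd_le L
    rw [← Real.norm_eq_abs]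
    linarith

/-- Absorption inequality `|y| ≤ (κ + y²/κ)/2` for `κ > 0`. -/
theorem abs_le_half_add_sq_div {y κ : ℝ} (hκ : 0 < κ) : |y| ≤ (κ + y ^ 2 / κ) / 2 := by
  rw [le_div_iff₀ (by norm_num : (0:ℝ) < 2)]
  have h0 : 0 ≤ (|y| - κ) ^ 2 / κ := by positivity
  have h2 : (|y| - κ) ^ 2 / κ = y ^ 2 / κ - 2 * |y| + κ := by
    field_simp
    rw [← sq_abs y]
    ring
  linarith

/-- The squared distance `Δ₁² + Σⱼ Δ₂ⱼ² + Δ₃²` written with the Euclidean norm of the middle block. -/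
theorem sum_sq_components (Y : (ℝ × V3 × ℝ)) :
    Y.1 ^ 2 + (∑ j, (Y.2.1 j) ^ 2) + Y.2.2 ^ 2 = Y.1 ^ 2 + ‖Y.2.1‖ ^ 2 + Y.2.2 ^ 2 := by
  rw [EuclideanSpace.norm_sq_eq]
  simp

/-- The `√δ`-absorption of the initial pairing: with all components of `L` bounded by `M` and
`κ > 0`, `|pair L Y| ≤ (M/2) (5κ + (Y₁² + ‖Y₂‖² + Y₃²)/κ)`. -/
theorem abs_pair_le_sqrt_absorb (pair : (ℝ × V3 × ℝ) → (ℝ × V3 × ℝ) → ℝ)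
    (hpair : pair = fun L U => L.1 * U.1 + (∑ j, L.2.1 j * U.2.1 j) + L.2.2 * U.2.2)
    {L : (ℝ × V3 × ℝ)} {M κ : ℝ} (h1 : |L.1| ≤ M) (h2 : ∀ j, |L.2.1 j| ≤ M) (h3 : |L.2.2| ≤ M)
    (hκ : 0 < κ) (Y : (ℝ × V3 × ℝ)) :
    |pair L Y| ≤ M / 2 * (5 * κ + (Y.1 ^ 2 + ‖Y.2.1‖ ^ 2 + Y.2.2 ^ 2) / κ) := by
  have hM : 0 ≤ M := (abs_nonneg _).trans h1
  refine (abs_pair_le pair hpair h1 h2 h3 Y).trans ?_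
  have e1 := abs_le_half_add_sq_div (y := Y.1) hκ
  have e2 := fun j => abs_le_half_add_sq_div (y := Y.2.1 j) hκ
  have e3 := abs_le_half_add_sq_div (y := Y.2.2) hκ
  have hsum : (∑ j, |Y.2.1 j|) ≤ ∑ j : Fin 3, (κ + (Y.2.1 j) ^ 2 / κ) / 2 :=
    Finset.sum_le_sum fun j _ => e2 j
  rw [← sum_sq_components]
  have hS : |Y.1| + (∑ j, |Y.2.1 j|) + |Y.2.2| ≤
      1 / 2 * (5 * κ + (Y.1 ^ 2 + (∑ j, (Y.2.1 j) ^ 2) + Y.2.2 ^ 2) / κ) := by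
    simp only [Fin.sum_univ_three] at hsum ⊢
    have : (5 * κ + (Y.1 ^ 2 + ((Y.2.1 0) ^ 2 + (Y.2.1 1) ^ 2 + (Y.2.1 2) ^ 2) + Y.2.2 ^ 2) / κ) =
        (κ + Y.1 ^ 2 / κ) + ((κ + (Y.2.1 0) ^ 2 / κ) + (κ + (Y.2.1 1) ^ 2 / κ) +
          (κ + (Y.2.1 2) ^ 2 / κ)) + (κ + Y.2.2 ^ 2 / κ) := by
      field_simp; ring
    rw [this]
    linarith
  calc M * (|Y.1| + (∑ j, |Y.2.1 j|) + |Y.2.2|)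
      ≤ M * (1 / 2 * (5 * κ + (Y.1 ^ 2 + (∑ j, (Y.2.1 j) ^ 2) + Y.2.2 ^ 2) / κ)) :=
        mul_le_mul_of_nonneg_left hS hM
    _ = M / 2 * (5 * κ + (Y.1 ^ 2 + (∑ j, (Y.2.1 j) ^ 2) + Y.2.2 ^ 2) / κ) := by ring

/-! ### Measurability and integrability -/

/-- A function continuous on `K` composed with a measurable `K`-valued map is measurable. -/
theorem measurable_comp_of_continuousOn {α : Type*} [MeasurableSpace α] {K : Set (ℝ × V3 × ℝ)}
    {f : (ℝ × V3 × ℝ) → ℝ} (hf : ContinuousOn f K) {g : α → (ℝ × V3 × ℝ)} (hg : Measurable g) (hgK : ∀ a, g a ∈ K) :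
    Measurable (fun a => f (g a)) := by
  have h1 : Continuous (K.restrict f) := hf.restrict
  have h2 : Measurable (fun a => (⟨g a, hgK a⟩ : K)) := hg.subtype_mk
  exact h1.measurable.comp h2

/-- Vector-valued version of `measurable_comp_of_continuousOn`. -/
theorem measurable_comp_of_continuousOn' {α : Type*} [MeasurableSpace α] {K : Set (ℝ × V3 × ℝ)}
    {f : (ℝ × V3 × ℝ) → (ℝ × V3 × ℝ)} (hf : ContinuousOn f K) {g : α → (ℝ × V3 × ℝ)} (hg : Measurable g) (hgK : ∀ a, g a ∈ K) :
    Measurable (fun a => f (g a)) := by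
  have h1 : Continuous (K.restrict f) := hf.restrict
  have h2 : Measurable (fun a => (⟨g a, hgK a⟩ : K)) := hg.subtype_mk
  exact h1.measurable.comp h2

/-- A measurable real function on `𝕋³` bounded by a constant is integrable. -/
theorem integrable_of_abs_le {f : T3 → ℝ} (hf : Measurable f) {B : ℝ} (hB : ∀ x, |f x| ≤ B) :
    Integrable f volume :=
  (integrable_const B).mono' hf.aestronglyMeasurable
    (Eventually.of_forall fun x => by rw [Real.norm_eq_abs]; exact hB x)

/-- The space integral of a jointly measurable function is measurable in time. -/
theorem measurable_integral_of_measurable {F : ℝ × T3 → ℝ} (hF : Measurable F) :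
    Measurable (fun τ => ∫ x, F (τ, x)) :=
  (hF.stronglyMeasurable.integral_prod_right' (ν := volume)).measurable

/-- The space integral of a function bounded by `B` in absolute value is bounded by `B`
(`𝕋³` has volume one). -/
theorem abs_integral_le_of_abs_le {f : T3 → ℝ} {B : ℝ} (hB : ∀ x, |f x| ≤ B) :
    |∫ x, f x| ≤ B := by
  have h := norm_integral_le_of_norm_le_const (μ := (volume : Measure T3)) (f := f) (C := B)
    (Eventually.of_forall fun x => by rw [Real.norm_eq_abs]; exact hB x)
  rw [probReal_univ, mul_one, Real.norm_eq_abs] at h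
  exact h

/-- A measurable function on `ℝ` bounded on `[0, t]` is interval integrable on `[0, s]` for
`s ∈ [0, t]`. -/
theorem intervalIntegrable_of_bound_on {φ : ℝ → ℝ} (hφ : Measurable φ) {t B : ℝ}
    (hB : ∀ τ ∈ Icc 0 t, |φ τ| ≤ B) {s : ℝ} (hs : s ∈ Icc 0 t) :
    IntervalIntegrable φ volume 0 s := by
  rw [intervalIntegrable_iff_integrableOn_Icc_of_le hs.1]
  have hc : IntegrableOn (fun _ : ℝ => B) (Icc 0 s) volume := continuousOn_const.integrableOn_Icc
  refine hc.mono' hφ.aestronglyMeasurable ?_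
  rw [ae_restrict_iff' measurableSet_Icc]
  exact Eventually.of_forall fun τ hτ => by
    rw [Real.norm_eq_abs]; exact hB τ ⟨hτ.1, hτ.2.trans hs.2⟩

/-! ### Uniform bounds by compactness -/

/-- A function continuous on the compact set `([0,t] × 𝕋³) × K` is bounded there. -/
theorem exists_bound_of_continuousOn_slab {K : Set (ℝ × V3 × ℝ)} (hK : IsCompact K) {t : ℝ}
    {G : (ℝ × T3) × (ℝ × V3 × ℝ) → ℝ} (hG : ContinuousOn G ((Icc 0 t ×ˢ univ) ×ˢ K)) :
    ∃ B, 0 ≤ B ∧ ∀ τ ∈ Icc 0 t, ∀ x, ∀ V ∈ K, |G ((τ, x), V)| ≤ B := by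
  obtain ⟨B, hB⟩ := ((isCompact_Icc.prod isCompact_univ).prod hK).exists_bound_of_continuousOn hG
  refine ⟨max B 0, le_max_right _ _, fun τ hτ x V hV => ?_⟩
  have h := hB ((τ, x), V) ⟨⟨hτ, mem_univ _⟩, hV⟩
  rw [Real.norm_eq_abs] at h
  exact h.trans (le_max_left _ _)

/-- A function continuous on the compact set `[0,t] × 𝕋³` is bounded there. -/
theorem exists_bound_of_continuousOn_slab' {t : ℝ} {G : ℝ × T3 → ℝ}
    (hG : ContinuousOn G (Icc 0 t ×ˢ univ)) :
    ∃ B, 0 ≤ B ∧ ∀ τ ∈ Icc 0 t, ∀ x, |G (τ, x)| ≤ B := by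
  obtain ⟨B, hB⟩ := (isCompact_Icc.prod isCompact_univ).exists_bound_of_continuousOn hG
  refine ⟨max B 0, le_max_right _ _, fun τ hτ x => ?_⟩
  have h := hB (τ, x) ⟨hτ, mem_univ _⟩
  rw [Real.norm_eq_abs] at h
  exact h.trans (le_max_left _ _)

/-! ### Grönwall for a bounded measurable function -/

/-- **Grönwall, integral form, for a measurable function bounded on `[0, t]`.** If
`|φ| ≤ B` on `[0, t]`, `φ` is measurable, `C ≥ 0`, and `φ s ≤ A + C ∫₀ˢ φ` for `s ∈ [0, t]`,
then `φ s ≤ A exp(C t)` on `[0, t]` (apply the continuous Grönwall–Bellman lemma to the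
continuous majorant `s ↦ A + C ∫₀ˢ φ`, extended constantly outside `[0, t]`). -/
theorem gronwall_measurable_bounded {φ : ℝ → ℝ} (hφ : Measurable φ) {t A B C : ℝ} (ht : 0 ≤ t)
    (hA : 0 ≤ A) (hC : 0 ≤ C) (hB : ∀ τ ∈ Icc 0 t, |φ τ| ≤ B)
    (hle : ∀ s ∈ Icc 0 t, φ s ≤ A + C * ∫ τ in (0:ℝ)..s, φ τ) :
    ∀ s ∈ Icc 0 t, φ s ≤ A * Real.exp (C * t) := by
  -- the retraction onto `[0, t]`
  set π : ℝ → ℝ := fun s => max 0 (min t s) with hπ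
  have hπc : Continuous π := continuous_const.max (continuous_const.min continuous_id)
  have hπmem : ∀ s, π s ∈ Icc 0 t := fun s => ⟨le_max_left _ _, max_le ht (min_le_left _ _)⟩
  have hπid : ∀ s ∈ Icc 0 t, π s = s := fun s hs => by
    simp only [hπ, min_eq_right hs.2, max_eq_right hs.1]
  have hii : ∀ s ∈ Icc 0 t, IntervalIntegrable φ volume 0 s :=
    fun s hs => intervalIntegrable_of_bound_on hφ hB hs
  -- the continuous majorant
  set g : ℝ → ℝ := fun s => A + C * ∫ τ in (0:ℝ)..(π s), φ τ with hg
  have hgc : Continuous g := by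
    have h1 : ContinuousOn (fun s => ∫ τ in (0:ℝ)..s, φ τ) (uIcc 0 t) := by
      refine intervalIntegral.continuousOn_primitive_interval ?_
      rw [uIcc_of_le ht]
      exact (intervalIntegrable_iff_integrableOn_Icc_of_le ht).1 (hii t (right_mem_Icc.2 ht))
    have h2 : Continuous (fun s => ∫ τ in (0:ℝ)..(π s), φ τ) :=
      h1.comp_continuous hπc fun s => by rw [uIcc_of_le ht]; exact hπmem s
    exact continuous_const.add (continuous_const.mul h2)
  have hφg : ∀ s ∈ Icc 0 t, φ s ≤ g s := fun s hs => by
    simp only [hg, hπid s hs]; exact hle s hs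
  -- `g` satisfies the linear integral inequality
  have hgle : ∀ s ∈ Icc 0 t, g s ≤ A + ∫ τ in (0:ℝ)..s, C * g τ := by
    intro s hs
    have hsub : ∀ τ ∈ Icc 0 s, τ ∈ Icc 0 t := fun τ hτ => ⟨hτ.1, hτ.2.trans hs.2⟩
    have hmono : ∫ τ in (0:ℝ)..s, φ τ ≤ ∫ τ in (0:ℝ)..s, g τ :=
      intervalIntegral.integral_mono_on hs.1 (hii s hs) (hgc.intervalIntegrable _ _)
        fun τ hτ => hφg τ (hsub τ hτ)
    have hgs : g s = A + C * ∫ τ in (0:ℝ)..s, φ τ := by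
      simp only [hg, hπid s hs]
    rw [hgs, intervalIntegral.integral_const_mul]
    linarith [mul_le_mul_of_nonneg_left hmono hC]
  have hG := Literature.Analysis.ODE.gronwall_integral_le_on (a := fun _ => C) (g := g)
    (h := fun _ => A) (T := t) continuous_const hgc (fun _ => hC) (fun _ _ _ _ _ => le_rfl) hgle
  intro s hs
  have h1 := hG s hs
  rw [intervalIntegral.integral_const, smul_eq_mul, sub_zero] at h1
  calc φ s ≤ g s := hφg s hs
    _ ≤ A * Real.exp (s * C) := h1
    _ ≤ A * Real.exp (C * t) := by
        refine mul_le_mul_of_nonneg_left (Real.exp_le_exp.2 ?_) hA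
        rw [mul_comm]; exact mul_le_mul_of_nonneg_left hs.2 hC

end Summit.AtomisticToContinuum.HydrodynamicLimit.Theorems.EntropicWeakStrong

end
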